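import Summits.QuantumFields.QCD.Theses.NestedDissectionSea
import Literature.MathematicalPhysics.QuantumFieldTheory.QCDPhaseQuenched
import Literature.MathematicalPhysics.QuantumFieldTheory.QCDPhaseQuenchedReweighting

/-!
# Stub `stub_pinOfFloor` of line `mass-wegner-cell-index` (crux `NegativeCellsDilute`, skeleton v4)

PIN FROM FLOOR AND MIXING — the bookkeeping step of the grafted `sign-mobility` mechanism. Given the
two sibling packages as hypotheses (S1: the heat-bath flip propensity of every finite link set is
measurable, `[0,1]`-valued and orthogonal to the sign `σ = sgn Re det D_W(μp)` under the phase-quenched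
probability measure; S2: the abstract second-moment step), a `k`-uniform floor `⟨m_b⟩₊ ≥ p₀` on the
block flip propensity plus relative clustering `≤ θ` of far-apart blocks give the crux's parity pin
`1/4 ≤ P₊(Re det D_W < 0)` on every odd torus holding `K = k₁⁴` pairwise-apart blocks, `k₁ = ⌈8/p₀⌉`,
because `1/(K p₀) + θ ≤ 1/8 + 1/8`.

* `pinOfFloor_fit`: for `a ≤ 1`, `k₁ (L_b + d₀ + 2) ≤ a N` makes the grid of blocks of side
  `n = ⌈L_b/a⌉` and gap `g = ⌈d₀/a⌉` fit: `k₁ (n + g) ≤ N`.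
* `pinOfFloor_grid_apart`: distinct grid points `I (n+g)`, `I' (n+g)` (`I, I' ∈ {0,…,k₁−1}⁴`) differ in
  a coordinate where all block coordinates are at cyclic distance `≥ g` both ways on `ℤ/N` (the integer
  difference `D` has `g + 1 ≤ |D| ≤ k₁ (n + g) − g − 1`).
* `pinOfFloor_prob`: the floor forces `0 < ∫ |det D| dμ_W`, so `qcdLatticeMeasure` is a probability
  measure; S2 applies (means and covariances are `⟨·⟩₊ = ∫ · d(qcdLatticeMeasure)`), and
  `P{σ = −1} = ∫ 1_{Re det < 0} dP = ⟨1_{Re det < 0}⟩₊` is the crux's quotient (`qcdPhaseQuenchedExpect_eq_div_prod`).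
* `pinOfFloor_at` threads the `let`-bound block data of one lattice through the grid; the stub takes
  `R₀ = max R_f (k₁ (L_b + d₀ + 2))` and intersects the hypothesis with `∀ᶠ k, a_k ≤ 1`.
-/

noncomputable section

namespace Summit.QuantumFields.QCD.Cruxes.NegativeCellsDilute.MassWegnerCellIndex

open scoped BigOperators ENNReal Classical
open MeasureTheory Filter
open Literature.MathematicalPhysics.QuantumLattice Literature.MathematicalPhysics.QuantumFieldTheory
  Literature.Probability.LatticeModels

/-! ### Arithmetic of the block grid -/

/-- Grid fit: if `k₁ (L_b + d₀ + 2) ≤ a N` with `0 < a ≤ 1` then `k₁ (⌈L_b/a⌉ + ⌈d₀/a⌉) ≤ N`. -/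
private theorem pinOfFloor_fit {a Lb d₀ : ℝ} {k₁ N : ℕ} (ha : 0 < a) (ha1 : a ≤ 1) (hLb : 0 ≤ Lb)
    (hd₀ : 0 ≤ d₀) (h : (k₁ : ℝ) * (Lb + d₀ + 2) ≤ a * N) :
    k₁ * (⌈Lb / a⌉₊ + ⌈d₀ / a⌉₊) ≤ N := by
  have hn : (⌈Lb / a⌉₊ : ℝ) ≤ Lb / a + 1 := (Nat.ceil_lt_add_one (by positivity)).le
  have hg : (⌈d₀ / a⌉₊ : ℝ) ≤ d₀ / a + 1 := (Nat.ceil_lt_add_one (by positivity)).le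
  have h1 : (k₁ : ℝ) * (⌈Lb / a⌉₊ + ⌈d₀ / a⌉₊) ≤ k₁ * ((Lb + d₀ + 2) / a) := by
    refine mul_le_mul_of_nonneg_left ?_ (Nat.cast_nonneg _)
    have h2 : (2 : ℝ) ≤ 2 / a := by rw [le_div_iff₀ ha]; nlinarith
    calc (⌈Lb / a⌉₊ : ℝ) + ⌈d₀ / a⌉₊ ≤ Lb / a + 1 + (d₀ / a + 1) := add_le_add hn hg
      _ ≤ Lb / a + d₀ / a + 2 / a := by linarith
      _ = (Lb + d₀ + 2) / a := by ring
  have h3 : (k₁ : ℝ) * ((Lb + d₀ + 2) / a) ≤ N := by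
    rw [← mul_div_assoc, div_le_iff₀ ha, mul_comm (N : ℝ)]
    exact h
  exact_mod_cast h1.trans h3

/-- On `ℤ/N`, a natural `d` with `g ≤ d` and `d + g ≤ N` is at cyclic distance `≥ g` from `0` in both
directions. -/
private theorem pinOfFloor_val_ge_nat {N : ℕ} [NeZero N] {g d : ℕ} (h1 : g ≤ d) (h2 : d + g ≤ N) :
    g ≤ ((d : ZMod N)).val ∧ g ≤ (-(d : ZMod N)).val := by
  rcases Nat.eq_zero_or_pos g with hg | hg
  · subst hg; exact ⟨Nat.zero_le _, Nat.zero_le _⟩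
  have hval : ((d : ZMod N)).val = d := ZMod.val_cast_of_lt (by omega)
  refine ⟨by rw [hval]; exact h1, ?_⟩
  have hne : (d : ZMod N) ≠ 0 := fun h0 => by
    have := congrArg ZMod.val h0
    rw [hval, ZMod.val_zero] at this
    omega
  rw [ZMod.neg_val, if_neg hne, hval]
  omega

/-- Integer version: `g ≤ |D|` and `|D| + g ≤ N` give cyclic distance `≥ g` both ways. -/
private theorem pinOfFloor_val_ge_int {N : ℕ} [NeZero N] {g : ℕ} {D : ℤ} (h1 : (g : ℤ) ≤ |D|)
    (h2 : |D| + g ≤ N) : g ≤ ((D : ZMod N)).val ∧ g ≤ (-(D : ZMod N)).val := by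
  rcases le_or_gt 0 D with hD | hD
  · rw [abs_of_nonneg hD] at h1 h2
    obtain ⟨d, rfl⟩ := Int.eq_ofNat_of_zero_le hD
    rw [Int.cast_natCast]
    exact pinOfFloor_val_ge_nat (by exact_mod_cast h1) (by exact_mod_cast h2)
  · rw [abs_of_neg hD] at h1 h2
    obtain ⟨d, hd⟩ := Int.eq_ofNat_of_zero_le (neg_pos.2 hD).le
    rw [hd] at h1 h2
    rw [show D = -(d : ℤ) by rw [← hd, neg_neg], Int.cast_neg, Int.cast_natCast, neg_neg]
    exact (pinOfFloor_val_ge_nat (N := N) (by exact_mod_cast h1) (by exact_mod_cast h2)).symm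

/-- Grid apartness: two distinct points of the grid `I ↦ (I i (n + g))_i`, `I : Fin 4 → Fin k₁`,
`k₁ (n + g) ≤ N`, carry `g`-apart blocks of side `n`. -/
private theorem pinOfFloor_grid_apart {N : ℕ} [NeZero N] {n g k₁ : ℕ} (hfit : k₁ * (n + g) ≤ N)
    (I I' : Fin 4 → Fin k₁) (hII' : I ≠ I') :
    ∃ i : Fin 4, ∀ t t' : ℕ, t < n → t' < n →
      g ≤ (((((I i : ℕ) * (n + g) : ℕ) : ZMod N) + (t : ZMod N)) -
          ((((I' i : ℕ) * (n + g) : ℕ) : ZMod N) + (t' : ZMod N))).val ∧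
        g ≤ (((((I' i : ℕ) * (n + g) : ℕ) : ZMod N) + (t' : ZMod N)) -
          ((((I i : ℕ) * (n + g) : ℕ) : ZMod N) + (t : ZMod N))).val := by
  obtain ⟨i, hi⟩ := Function.ne_iff.1 hII'
  refine ⟨i, fun t t' ht ht' => ?_⟩
  -- the integer difference of the two coordinates
  set D : ℤ := ((I i : ℕ) * (n + g) + t : ℤ) - ((I' i : ℕ) * (n + g) + t' : ℤ) with hD
  have hcast : ((((I i : ℕ) * (n + g) : ℕ) : ZMod N) + (t : ZMod N)) -
      ((((I' i : ℕ) * (n + g) : ℕ) : ZMod N) + (t' : ZMod N)) = (D : ZMod N) := by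
    rw [hD]; push_cast; ring
  have hcast' : ((((I' i : ℕ) * (n + g) : ℕ) : ZMod N) + (t' : ZMod N)) -
      ((((I i : ℕ) * (n + g) : ℕ) : ZMod N) + (t : ZMod N)) = -(D : ZMod N) := by
    rw [← hcast, neg_sub]
  rw [hcast, hcast']
  -- `g + 1 ≤ |D|` and `|D| + g + 1 ≤ k₁ (n + g) ≤ N`, by linear arithmetic over the monomials
  have hP : (0 : ℤ) ≤ n + g := by positivity
  have hu := mul_le_mul_of_nonneg_right (show ((I i : ℕ) : ℤ) + 1 ≤ k₁ by exact_mod_cast (I i).isLt) hP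
  have hv := mul_le_mul_of_nonneg_right (show ((I' i : ℕ) : ℤ) + 1 ≤ k₁ by exact_mod_cast (I' i).isLt) hP
  have hu0 : (0 : ℤ) ≤ ((I i : ℕ) : ℤ) * (n + g) := by positivity
  have hv0 : (0 : ℤ) ≤ ((I' i : ℕ) : ℤ) * (n + g) := by positivity
  have hfit' : (k₁ : ℤ) * (n + g) ≤ N := by exact_mod_cast hfit
  have ht : (t : ℤ) + 1 ≤ n := by exact_mod_cast ht
  have ht' : (t' : ℤ) + 1 ≤ n := by exact_mod_cast ht'
  refine pinOfFloor_val_ge_int ?_ (by have := abs_le.2 (⟨by linarith, by linarith⟩ : -((N : ℤ) - g) ≤ D ∧ D ≤ N - g); linarith)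
  rcases Nat.lt_or_gt_of_ne (fun h : (I i : ℕ) = I' i => hi (Fin.ext h)) with hlt | hlt
  · have := mul_le_mul_of_nonneg_right (show ((I i : ℕ) : ℤ) + 1 ≤ (I' i : ℕ) by exact_mod_cast hlt) hP
    exact le_abs.2 (Or.inr (by linarith))
  · have := mul_le_mul_of_nonneg_right (show ((I' i : ℕ) : ℤ) + 1 ≤ (I i : ℕ) by exact_mod_cast hlt) hP
    exact le_abs.2 (Or.inl (by linarith))

/-! ### The second-moment step on the phase-quenched probability space -/

/-- Given S2: `K ≥ 1` measurable `[0,1]`-valued propensities orthogonal to the sign `σ`, with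
phase-quenched means `≥ p₀ > 0` and relative covariances `≤ θ`, `1/(K p₀) + θ ≤ 1/4`, pin the crux's
quotient `⟨1_{Re det D_W(μp) < 0}⟩₊ = P₊{σ = −1}` at `≥ 1/4`. -/
private theorem pinOfFloor_prob
    (hS2 : ∀ (Ω : Type) [MeasurableSpace Ω] (P : Measure Ω) [IsProbabilityMeasure P] (K : ℕ)
      (σ : Ω → ℝ) (mb : Fin K → Ω → ℝ) (p₀ θ : ℝ),
      0 < K → Measurable σ → (∀ ω, σ ω = 1 ∨ σ ω = -1) →
      (∀ b, Measurable (mb b)) → (∀ b ω, 0 ≤ mb b ω ∧ mb b ω ≤ 1) →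
      (∀ b, ∫ ω, σ ω * mb b ω ∂P = 0) →
      0 < p₀ → (∀ b, p₀ ≤ ∫ ω, mb b ω ∂P) → 0 ≤ θ →
      (∀ b b', b ≠ b' →
        ∫ ω, mb b ω * mb b' ω ∂P - (∫ ω, mb b ω ∂P) * (∫ ω, mb b' ω ∂P) ≤
          θ * ((∫ ω, mb b ω ∂P) * ∫ ω, mb b' ω ∂P)) →
      1 / ((K : ℝ) * p₀) + θ ≤ 1 / 4 →
      (1 / 4 : ℝ) ≤ (P {ω | σ ω = -1}).toReal)
    {N : ℕ} [NeZero N] {Nf : ℕ} (β : ℝ) (mq : Fin Nf → ℝ) (μp : ℝ) {K : ℕ} (hK : 0 < K)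
    (mb : Fin K → GaugeConfig 4 N SU3 → ℝ) {p₀ θ : ℝ} (hp₀ : 0 < p₀) (hθ : 0 ≤ θ)
    (hnum : 1 / ((K : ℝ) * p₀) + θ ≤ 1 / 4)
    (hmb : ∀ b, Measurable (mb b) ∧ (∀ U, 0 ≤ mb b U ∧ mb b U ≤ 1) ∧
      ∫ U, (if (fermionDet (wilsonDirac (fundamentalRep (Fin 3)) U μp 1)).re < 0 then (-1 : ℝ) else 1) *
        mb b U ∂(qcdLatticeMeasure N β mq) = 0)
    (hfloor : ∀ b, p₀ ≤ qcdPhaseQuenchedExpect β N mq (mb b))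
    (hmix : ∀ b b', b ≠ b' →
      qcdPhaseQuenchedExpect β N mq (fun U => mb b U * mb b' U) -
          qcdPhaseQuenchedExpect β N mq (mb b) * qcdPhaseQuenchedExpect β N mq (mb b') ≤
        θ * (qcdPhaseQuenchedExpect β N mq (mb b) * qcdPhaseQuenchedExpect β N mq (mb b'))) :
    (1 / 4 : ℝ) ≤
      (∫ U : GaugeConfig 4 N (Matrix.specialUnitaryGroup (Fin 3) ℂ),
          (if (fermionDet (wilsonDirac (fundamentalRep (Fin 3)) U μp 1)).re < 0 then (1 : ℝ) else 0) *
            ∏ f, ‖fermionDet (wilsonDirac (fundamentalRep (Fin 3)) U (mq f) 1)‖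
          ∂(wilsonMeasure (fundamentalRep (Fin 3)) β)) /
        (∫ U : GaugeConfig 4 N (Matrix.specialUnitaryGroup (Fin 3) ℂ),
          ∏ f, ‖fermionDet (wilsonDirac (fundamentalRep (Fin 3)) U (mq f) 1)‖
          ∂(wilsonMeasure (fundamentalRep (Fin 3)) β)) := by
  -- the phase-quenched measure is a probability measure: the floor forces `0 < ∫ |det D| dμ_W`
  have hden : 0 < ∫ U, ‖(diracMatrix U mq).det‖
      ∂(wilsonMeasure (d := 4) (L := N) (fundamentalRep (Fin 3)) β) := by
    by_contra h
    have h0 := le_antisymm (not_lt.1 h) (integral_nonneg fun U => norm_nonneg _)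
    have h1 := hfloor ⟨0, hK⟩
    rw [qcdPhaseQuenchedExpect_def, h0, inv_zero, zero_smul] at h1
    exact absurd h1 (not_le.2 hp₀)
  haveI := isProbabilityMeasure_qcdLatticeMeasure (S := N) β mq hden
  -- the sign is measurable and `±1`-valued, and `{σ = -1} = {Re det < 0}`
  set sg : GaugeConfig 4 N SU3 → ℝ := fun U =>
    if (fermionDet (wilsonDirac (fundamentalRep (Fin 3)) U μp 1)).re < 0 then -1 else 1 with hsg
  have hA : MeasurableSet {U : GaugeConfig 4 N SU3 |
      (fermionDet (wilsonDirac (fundamentalRep (Fin 3)) U μp 1)).re < 0} :=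
    measurableSet_lt (Complex.continuous_re.comp ((continuous_wilsonDirac (fundamentalRep (Fin 3))
      (continuous_fundamentalRep (Fin 3)) μp 1).matrix_det)).measurable measurable_const
  have hsgm : Measurable sg := Measurable.ite hA measurable_const measurable_const
  have hsgv : ∀ U, sg U = 1 ∨ sg U = -1 := fun U => by
    simp only [hsg]; split_ifs <;> simp
  have hset : {U | sg U = -1} =
      {U : GaugeConfig 4 N SU3 | (fermionDet (wilsonDirac (fundamentalRep (Fin 3)) U μp 1)).re < 0} := by
    ext U
    simp only [Set.mem_setOf_eq, hsg]
    split_ifs with h <;> norm_num [h]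
  -- S2 on the phase-quenched probability space
  have key := hS2 (GaugeConfig 4 N SU3) (qcdLatticeMeasure N β mq) K sg mb p₀ θ hK hsgm hsgv
    (fun b => (hmb b).1) (fun b => (hmb b).2.1) (fun b => (hmb b).2.2) hp₀
    (fun b => by rw [← qcdPhaseQuenchedExpect_eq_integral_qcdLatticeMeasure]; exact hfloor b) hθ
    (fun b b' hbb' => by
      simpa only [qcdPhaseQuenchedExpect_eq_integral_qcdLatticeMeasure] using hmix b b' hbb') hnum
  -- `P{σ = -1} = ⟨1_{Re det < 0}⟩₊`, the crux's quotient
  calc (1 / 4 : ℝ) ≤ ((qcdLatticeMeasure N β mq) {U | sg U = -1}).toReal := key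
    _ = ∫ U, (if (fermionDet (wilsonDirac (fundamentalRep (Fin 3)) U μp 1)).re < 0 then (1 : ℝ) else 0)
          ∂(qcdLatticeMeasure N β mq) := by
      rw [hset, ← measureReal_def, ← integral_indicator_one hA]
      refine integral_congr_ae (Eventually.of_forall fun U => ?_)
      simp only [Set.indicator_apply, Set.mem_setOf_eq, Pi.one_apply]
    _ = qcdPhaseQuenchedExpect β N mq (fun U =>
          if (fermionDet (wilsonDirac (fundamentalRep (Fin 3)) U μp 1)).re < 0 then (1 : ℝ) else 0) :=
      (qcdPhaseQuenchedExpect_eq_integral_qcdLatticeMeasure β mq _).symm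
    _ = _ := qcdPhaseQuenchedExpect_eq_div_prod β mq _

/-! ### One lattice: the grid of blocks -/

/-- **The pin on one lattice.** On the torus of side `N ≥ k₁ (n + g)`, given S1 and S2, a floor
`⟨m_b⟩₊ ≥ p₀` on the flip propensity of every block of side `n` and relative clustering `≤ θ` of
`g`-apart blocks, with `1/(k₁⁴ p₀) + θ ≤ 1/4`, pin the crux's quotient at `≥ 1/4`: the `k₁⁴` grid
blocks based at `I (n + g)`, `I ∈ {0,…,k₁−1}⁴`, are pairwise `g`-apart (`pinOfFloor_grid_apart`). -/
private theorem pinOfFloor_at (hS1 : ∀ (N : ℕ) [NeZero N] (Nf : ℕ) (β : ℝ) (mq : Fin Nf → ℝ) (μp : ℝ) (B : Finset (Edge 4 N)),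
      let σ : GaugeConfig 4 N SU3 → ℝ := fun U =>
        if (fermionDet (wilsonDirac (fundamentalRep (Fin 3)) U μp 1)).re < 0 then -1 else 1
      let w : GaugeConfig 4 N SU3 → ℝ := fun U =>
        Real.exp (-(β * wilsonAction (fundamentalRep (Fin 3)) U)) *
          ∏ f, ‖fermionDet (wilsonDirac (fundamentalRep (Fin 3)) U (mq f) 1)‖
      let r : GaugeConfig 4 N SU3 → GaugeConfig 4 N SU3 → GaugeConfig 4 N SU3 := fun U V e =>
        if e ∈ B then V e else U e
      let mB : GaugeConfig 4 N SU3 → ℝ := fun U =>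
        (∫ V, (if σ (r U V) ≠ σ U then (1 : ℝ) else 0) * w (r U V)
            ∂(Measure.pi fun _ : Edge 4 N => haarProbability SU3)) /
          (∫ V, w (r U V) ∂(Measure.pi fun _ : Edge 4 N => haarProbability SU3))
      Measurable mB ∧ (∀ U, 0 ≤ mB U ∧ mB U ≤ 1) ∧
        ∫ U, σ U * mB U ∂(qcdLatticeMeasure N β mq) = 0)
    (hS2 : ∀ (Ω : Type) [MeasurableSpace Ω] (P : Measure Ω) [IsProbabilityMeasure P] (K : ℕ)
      (σ : Ω → ℝ) (mb : Fin K → Ω → ℝ) (p₀ θ : ℝ),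
      0 < K → Measurable σ → (∀ ω, σ ω = 1 ∨ σ ω = -1) →
      (∀ b, Measurable (mb b)) → (∀ b ω, 0 ≤ mb b ω ∧ mb b ω ≤ 1) →
      (∀ b, ∫ ω, σ ω * mb b ω ∂P = 0) →
      0 < p₀ → (∀ b, p₀ ≤ ∫ ω, mb b ω ∂P) → 0 ≤ θ →
      (∀ b b', b ≠ b' →
        ∫ ω, mb b ω * mb b' ω ∂P - (∫ ω, mb b ω ∂P) * (∫ ω, mb b' ω ∂P) ≤
          θ * ((∫ ω, mb b ω ∂P) * ∫ ω, mb b' ω ∂P)) →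
      1 / ((K : ℝ) * p₀) + θ ≤ 1 / 4 →
      (1 / 4 : ℝ) ≤ (P {ω | σ ω = -1}).toReal)
    {Nf : ℕ} (N : ℕ) [NeZero N] (β : ℝ) (mq : Fin Nf → ℝ) (μp : ℝ) (n g k₁ : ℕ) {p₀ θ : ℝ}
    (hp₀ : 0 < p₀) (hθ : 0 ≤ θ) (hk₁ : 0 < k₁) (hnum : 1 / (((k₁ ^ 4 : ℕ) : ℝ) * p₀) + θ ≤ 1 / 4)
    (hfit : k₁ * (n + g) ≤ N) :
    let σ : GaugeConfig 4 N SU3 → ℝ := fun U =>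
      if (fermionDet (wilsonDirac (fundamentalRep (Fin 3)) U μp 1)).re < 0 then -1 else 1
    let w : GaugeConfig 4 N SU3 → ℝ := fun U =>
      Real.exp (-(β * wilsonAction (fundamentalRep (Fin 3)) U)) *
        ∏ f, ‖fermionDet (wilsonDirac (fundamentalRep (Fin 3)) U (mq f) 1)‖
    let blk : TorusSite 4 N → Finset (Edge 4 N) := fun x =>
      Finset.univ.filter fun e => ∀ i, (e.1 i - x i).val < n
    let r : Finset (Edge 4 N) → GaugeConfig 4 N SU3 → GaugeConfig 4 N SU3 → GaugeConfig 4 N SU3 :=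
      fun B U V e => if e ∈ B then V e else U e
    let mb : TorusSite 4 N → GaugeConfig 4 N SU3 → ℝ := fun x U =>
      (∫ V, (if σ (r (blk x) U V) ≠ σ U then (1 : ℝ) else 0) * w (r (blk x) U V)
          ∂(Measure.pi fun _ : Edge 4 N => haarProbability SU3)) /
        (∫ V, w (r (blk x) U V) ∂(Measure.pi fun _ : Edge 4 N => haarProbability SU3))
    ((∀ x : TorusSite 4 N, p₀ ≤ qcdPhaseQuenchedExpect β N mq (mb x)) ∧
      (∀ x x' : TorusSite 4 N,
        (∃ i : Fin 4, ∀ t t' : ℕ, t < n → t' < n →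
          g ≤ ((x i + (t : ZMod N)) - (x' i + (t' : ZMod N))).val ∧
            g ≤ ((x' i + (t' : ZMod N)) - (x i + (t : ZMod N))).val) →
        qcdPhaseQuenchedExpect β N mq (fun U => mb x U * mb x' U) -
            qcdPhaseQuenchedExpect β N mq (mb x) * qcdPhaseQuenchedExpect β N mq (mb x') ≤
          θ * (qcdPhaseQuenchedExpect β N mq (mb x) * qcdPhaseQuenchedExpect β N mq (mb x')))) →
    (1 / 4 : ℝ) ≤
      (∫ U : GaugeConfig 4 N (Matrix.specialUnitaryGroup (Fin 3) ℂ),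
          (if (fermionDet (wilsonDirac (fundamentalRep (Fin 3)) U μp 1)).re < 0 then (1 : ℝ) else 0) *
            ∏ f, ‖fermionDet (wilsonDirac (fundamentalRep (Fin 3)) U (mq f) 1)‖
          ∂(wilsonMeasure (fundamentalRep (Fin 3)) β)) /
        (∫ U : GaugeConfig 4 N (Matrix.specialUnitaryGroup (Fin 3) ℂ),
          ∏ f, ‖fermionDet (wilsonDirac (fundamentalRep (Fin 3)) U (mq f) 1)‖
          ∂(wilsonMeasure (fundamentalRep (Fin 3)) β)) := by
  intro σ w blk r mb hFM
  obtain ⟨hfl, hmx⟩ := hFM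
  -- the grid of `k₁⁴` blocks, indexed by `Fin K`
  set e := Fintype.equivFin (Fin 4 → Fin k₁)
  have hK : Fintype.card (Fin 4 → Fin k₁) = k₁ ^ 4 := by simp
  let xg : Fin (Fintype.card (Fin 4 → Fin k₁)) → TorusSite 4 N := fun b i =>
    (((e.symm b i : ℕ) * (n + g) : ℕ) : ZMod N)
  have hKpos : 0 < Fintype.card (Fin 4 → Fin k₁) := by rw [hK]; positivity
  have hnum' : 1 / ((Fintype.card (Fin 4 → Fin k₁) : ℝ) * p₀) + θ ≤ 1 / 4 := by rw [hK]; exact hnum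
  refine pinOfFloor_prob hS2 β mq μp hKpos (fun b => mb (xg b)) hp₀ hθ hnum'
    (fun b => hS1 N Nf β mq μp (blk (xg b))) (fun b => hfl (xg b))
    (fun b b' hbb' => hmx (xg b) (xg b') ?_)
  exact pinOfFloor_grid_apart hfit (e.symm b) (e.symm b') (fun h => hbb' (e.symm.injective h))

/-! ### The stub -/

/-- **PIN FROM FLOOR AND MIXING** (stub `stub_pinOfFloor` of skeleton v4, line `mass-wegner-cell-index`).
Given S1 (sign–mobility: every block flip propensity is measurable, `[0,1]`-valued and orthogonal to
the sign under the phase-quenched measure) and S2 (second-moment concentration ⇒ quarter pin) as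
hypotheses: for every `reg, M₀, m`, block data `L_b, d₀ > 0`, floor `p₀ > 0` and mixing constant
`0 ≤ θ ≤ 1/8`, floor-and-mixing implies the crux's parity pin on all odd tori of physical side
`≥ R₀ = max R_f (k₁ (L_b + d₀ + 2))`, `k₁ = ⌈8/p₀⌉` (so `1/(k₁⁴ p₀) + θ ≤ 1/4`): eventually `a_k ≤ 1`,
the grid of `k₁⁴` pairwise `⌈d₀/a_k⌉`-apart blocks of side `⌈L_b/a_k⌉` fits (`pinOfFloor_fit`), and
`pinOfFloor_at` applies. -/
theorem stub_pinOfFloor :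
    (∀ (N : ℕ) [NeZero N] (Nf : ℕ) (β : ℝ) (mq : Fin Nf → ℝ) (μp : ℝ) (B : Finset (Edge 4 N)),
      let σ : GaugeConfig 4 N SU3 → ℝ := fun U =>
        if (fermionDet (wilsonDirac (fundamentalRep (Fin 3)) U μp 1)).re < 0 then -1 else 1
      let w : GaugeConfig 4 N SU3 → ℝ := fun U =>
        Real.exp (-(β * wilsonAction (fundamentalRep (Fin 3)) U)) *
          ∏ f, ‖fermionDet (wilsonDirac (fundamentalRep (Fin 3)) U (mq f) 1)‖
      let r : GaugeConfig 4 N SU3 → GaugeConfig 4 N SU3 → GaugeConfig 4 N SU3 := fun U V e =>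
        if e ∈ B then V e else U e
      let mB : GaugeConfig 4 N SU3 → ℝ := fun U =>
        (∫ V, (if σ (r U V) ≠ σ U then (1 : ℝ) else 0) * w (r U V)
            ∂(Measure.pi fun _ : Edge 4 N => haarProbability SU3)) /
          (∫ V, w (r U V) ∂(Measure.pi fun _ : Edge 4 N => haarProbability SU3))
      Measurable mB ∧ (∀ U, 0 ≤ mB U ∧ mB U ≤ 1) ∧
        ∫ U, σ U * mB U ∂(qcdLatticeMeasure N β mq) = 0) →
    (∀ (Ω : Type) [MeasurableSpace Ω] (P : Measure Ω) [IsProbabilityMeasure P] (K : ℕ)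
      (σ : Ω → ℝ) (mb : Fin K → Ω → ℝ) (p₀ θ : ℝ),
      0 < K → Measurable σ → (∀ ω, σ ω = 1 ∨ σ ω = -1) →
      (∀ b, Measurable (mb b)) → (∀ b ω, 0 ≤ mb b ω ∧ mb b ω ≤ 1) →
      (∀ b, ∫ ω, σ ω * mb b ω ∂P = 0) →
      0 < p₀ → (∀ b, p₀ ≤ ∫ ω, mb b ω ∂P) → 0 ≤ θ →
      (∀ b b', b ≠ b' →
        ∫ ω, mb b ω * mb b' ω ∂P - (∫ ω, mb b ω ∂P) * (∫ ω, mb b' ω ∂P) ≤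
          θ * ((∫ ω, mb b ω ∂P) * ∫ ω, mb b' ω ∂P)) →
      1 / ((K : ℝ) * p₀) + θ ≤ 1 / 4 →
      (1 / 4 : ℝ) ≤ (P {ω | σ ω = -1}).toReal) →
    ∀ (Nf : ℕ) (reg : QCDRegularisation Nf) (M₀ : ℝ) (m : Fin Nf → ℝ) (Lb d₀ p₀ θ Rf : ℝ),
      0 < Lb → 0 < d₀ → 0 < p₀ → 0 ≤ θ → θ ≤ 1 / 8 →
      (∀ M : ℝ, M₀ < M → ∀ᶠ k : ℕ in Filter.atTop, ∀ S : ℕ, Rf ≤ reg.a k * (2 * S + 1) →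
        let N : ℕ := 2 * S + 1
        let mq : Fin Nf → ℝ := fun f => reg.mcrit k + reg.a k * m f / reg.Zm k
        let μp : ℝ := reg.mcrit k - reg.a k * M / reg.Zm k
        let n : ℕ := ⌈Lb / reg.a k⌉₊
        let g : ℕ := ⌈d₀ / reg.a k⌉₊
        let σ : GaugeConfig 4 N SU3 → ℝ := fun U =>
          if (fermionDet (wilsonDirac (fundamentalRep (Fin 3)) U μp 1)).re < 0 then -1 else 1
        let w : GaugeConfig 4 N SU3 → ℝ := fun U =>
          Real.exp (-(reg.β k * wilsonAction (fundamentalRep (Fin 3)) U)) *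
            ∏ f, ‖fermionDet (wilsonDirac (fundamentalRep (Fin 3)) U (mq f) 1)‖
        let blk : TorusSite 4 N → Finset (Edge 4 N) := fun x =>
          Finset.univ.filter fun e => ∀ i, (e.1 i - x i).val < n
        let r : Finset (Edge 4 N) → GaugeConfig 4 N SU3 → GaugeConfig 4 N SU3 → GaugeConfig 4 N SU3 :=
          fun B U V e => if e ∈ B then V e else U e
        let mb : TorusSite 4 N → GaugeConfig 4 N SU3 → ℝ := fun x U =>
          (∫ V, (if σ (r (blk x) U V) ≠ σ U then (1 : ℝ) else 0) * w (r (blk x) U V)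
              ∂(Measure.pi fun _ : Edge 4 N => haarProbability SU3)) /
            (∫ V, w (r (blk x) U V) ∂(Measure.pi fun _ : Edge 4 N => haarProbability SU3))
        (∀ x : TorusSite 4 N, p₀ ≤ qcdPhaseQuenchedExpect (reg.β k) N mq (mb x)) ∧
        (∀ x x' : TorusSite 4 N,
          (∃ i : Fin 4, ∀ t t' : ℕ, t < n → t' < n →
            g ≤ ((x i + (t : ZMod N)) - (x' i + (t' : ZMod N))).val ∧
              g ≤ ((x' i + (t' : ZMod N)) - (x i + (t : ZMod N))).val) →
          qcdPhaseQuenchedExpect (reg.β k) N mq (fun U => mb x U * mb x' U) -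
              qcdPhaseQuenchedExpect (reg.β k) N mq (mb x) * qcdPhaseQuenchedExpect (reg.β k) N mq (mb x') ≤
            θ * (qcdPhaseQuenchedExpect (reg.β k) N mq (mb x) *
              qcdPhaseQuenchedExpect (reg.β k) N mq (mb x')))) →
      ∃ R₀ : ℝ, 0 < R₀ ∧ ∀ R : ℝ, R₀ ≤ R →
      (∀ M : ℝ, M₀ < M → ∀ᶠ k : ℕ in Filter.atTop, ∀ S : ℕ, R ≤ reg.a k * (2 * S + 1) →
        (1 / 4 : ℝ) ≤
          (∫ U : GaugeConfig 4 (2 * S + 1) (Matrix.specialUnitaryGroup (Fin 3) ℂ), (if (fermionDet (wilsonDirac (fundamentalRep (Fin 3)) U (reg.mcrit k - reg.a k * M / reg.Zm k) 1)).re < 0 then (1 : ℝ) else 0) *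
                ∏ f, ‖fermionDet (wilsonDirac (fundamentalRep (Fin 3)) U (reg.mcrit k + reg.a k * m f / reg.Zm k) 1)‖ ∂(wilsonMeasure (fundamentalRep (Fin 3)) (reg.β k))) /
            (∫ U : GaugeConfig 4 (2 * S + 1) (Matrix.specialUnitaryGroup (Fin 3) ℂ),
                ∏ f, ‖fermionDet (wilsonDirac (fundamentalRep (Fin 3)) U (reg.mcrit k + reg.a k * m f / reg.Zm k) 1)‖ ∂(wilsonMeasure (fundamentalRep (Fin 3)) (reg.β k)))) := by
  intro hS1 hS2 Nf reg M₀ m Lb d₀ p₀ θ Rf hLb hd₀ hp₀ hθ hθ8 hFM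
  -- (1) the number of blocks per direction and the torus threshold
  obtain ⟨k₁, hk₁pos, hk₁⟩ : ∃ k₁ : ℕ, 0 < k₁ ∧ 8 / p₀ ≤ (k₁ : ℝ) :=
    ⟨⌈8 / p₀⌉₊, Nat.ceil_pos.2 (by positivity), Nat.le_ceil _⟩
  have hnum : 1 / (((k₁ ^ 4 : ℕ) : ℝ) * p₀) + θ ≤ 1 / 4 := by
    have h8 : (8 : ℝ) ≤ k₁ * p₀ := by rwa [div_le_iff₀ hp₀] at hk₁
    have hk4 : k₁ ≤ k₁ ^ 4 := Nat.le_self_pow (by norm_num) k₁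
    have h8' : (8 : ℝ) ≤ ((k₁ ^ 4 : ℕ) : ℝ) * p₀ :=
      h8.trans (mul_le_mul_of_nonneg_right (by exact_mod_cast hk4) hp₀.le)
    have h18 : 1 / (((k₁ ^ 4 : ℕ) : ℝ) * p₀) ≤ 1 / 8 := one_div_le_one_div_of_le (by norm_num) h8'
    linarith
  have hk₁r : (0 : ℝ) < k₁ := by exact_mod_cast hk₁pos
  refine ⟨max Rf ((k₁ : ℝ) * (Lb + d₀ + 2)), lt_max_of_lt_right (mul_pos hk₁r (by linarith)),
    fun R hR M hM => ?_⟩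
  -- (2) eventually the lattice spacing is `≤ 1` and floor-and-mixing holds; fix such `k` and `S`
  have ha1 : ∀ᶠ k : ℕ in atTop, reg.a k ≤ 1 := reg.tendsto_a.eventually (ge_mem_nhds one_pos)
  filter_upwards [hFM M hM, ha1] with k hk hak
  intro S hRS
  have hRf : Rf ≤ reg.a k * (2 * S + 1) := (le_max_left _ _).trans (hR.trans hRS)
  have hgrid : (k₁ : ℝ) * (Lb + d₀ + 2) ≤ reg.a k * ((2 * S + 1 : ℕ) : ℝ) := by
    push_cast
    exact (le_max_right _ _).trans (hR.trans hRS)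
  have hfit : k₁ * (⌈Lb / reg.a k⌉₊ + ⌈d₀ / reg.a k⌉₊) ≤ 2 * S + 1 :=
    pinOfFloor_fit (reg.a_pos k) hak hLb.le hd₀.le hgrid
  haveI : NeZero (2 * S + 1) := ⟨Nat.succ_ne_zero _⟩
  exact pinOfFloor_at hS1 hS2 (2 * S + 1) (reg.β k) (fun f => reg.mcrit k + reg.a k * m f / reg.Zm k)
    (reg.mcrit k - reg.a k * M / reg.Zm k) ⌈Lb / reg.a k⌉₊ ⌈d₀ / reg.a k⌉₊ k₁ hp₀ hθ hk₁pos hnum hfit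
    (hk S hRf)

end Summit.QuantumFields.QCD.Cruxes.NegativeCellsDilute.MassWegnerCellIndex

end
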